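import Mathlib
import Literature.Analysis.FunctionSpaces.PoissonPointProcess
import Literature.Analysis.FunctionSpaces.PoissonMecke
import Literature.Probability.Percolation.VoronoiCrossing
import Summits.CriticalPhenomena.CardyFormulaZ2.Theorems.CardyFlipRussoSquareFromVoronoiHubSmallCellsPart2

/-!
# Stub `stub_smallCells` (K0), Part 3 — line `Sketch`, crux `SquareFromVoronoiHub`
# (stmt-CriticalPhenomena-6434): one site — fairness, the void and tie estimates, colour forcing

Support file for the K0 stub of `Cruxes/SquareFromVoronoiHub/Lines/Sketch.lean`.  Fix a site with
macroscopic position `p`, the cell scale `s > 0` (nuclei `c = (c₁, c₂)` sit at `s • cᵢ`), and the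
`N` annuli `shell (p/s) w k`, `k < N`, of width `w` around the microscopic position `p/s`.  In terms
of the count vector `v = siteCounts _ i c` of the site:

* `Bblack N` (some black nucleus in annulus `k` and no white nucleus in annuli `≤ k`), `Bwhite N`
  (the mirror event), `Btie N` (an annulus containing nuclei of both colours), `Bnone N` (no
  nucleus in the `N` annuli) COVER all count vectors (`mem_union_B`);
* **colour forcing** (`infDist_le_of_mem_Bblack`, `infDist_lt_of_mem_Bwhite`): on `Bblack` (and
  `c₂ ≠ ∅`) the site is black for the block colouring, `infDist p (s•c₁) ≤ infDist p (s•c₂)`; on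
  `Bwhite` (and `c₁ ≠ ∅`) it is white;
* under `P ⊗ P`, `P` Poisson of Lebesgue intensity: `P(Bwhite) = P(Bblack)` (swap symmetry,
  `Measure.prod_swap`), `P(Bnone) ≤ e^{-2V}` (void probabilities, `V = π (N w)²` the area of the
  disc), `P(Btie) ≤ 2V²/N` (union bound, `1 - e^{-a} ≤ a`, annulus areas), hence the **fairness
  bound** `P(Bblack) = P(Bwhite) ≥ (1 - e^{-2V} - 2V²/N)/2` (`half_le_measureReal_Bblack`).

References: B. Bollobás, O. Riordan, *Percolation* (2006), Ch. 8 §8.3; J. F. C. Kingman,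
*Poisson Processes* (1993), §2.1.
-/

noncomputable section

open scoped Topology MeasureTheory ENNReal Pointwise
open Filter Set MeasureTheory ProbabilityTheory

namespace Summit.CriticalPhenomena.CardyFormulaZ2.Cruxes.SquareFromVoronoiHub.VoronoiBlocks.SmallCells

open Literature.Analysis.FunctionSpaces (PointConfig IsPoissonPointProcess)

/-! ### The four events of one site, on count vectors -/

/-- BLACK-forcing count vectors: a black nucleus in annulus `k`, no white nucleus in annuli `≤ k`.
[folklore] -/
def Bblack (N : ℕ) : Set (Fin N ⊕ Fin N → ℕ∞) :=
  {v | ∃ k, v (Sum.inl k) ≠ 0 ∧ ∀ j, j ≤ k → v (Sum.inr j) = 0}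

/-- WHITE-forcing count vectors: a white nucleus in annulus `k`, no black nucleus in annuli `≤ k`.
[folklore] -/
def Bwhite (N : ℕ) : Set (Fin N ⊕ Fin N → ℕ∞) :=
  {v | ∃ k, v (Sum.inr k) ≠ 0 ∧ ∀ j, j ≤ k → v (Sum.inl j) = 0}

/-- TIE count vectors: some annulus contains nuclei of both colours. [folklore] -/
def Btie (N : ℕ) : Set (Fin N ⊕ Fin N → ℕ∞) :=
  {v | ∃ k, v (Sum.inl k) ≠ 0 ∧ v (Sum.inr k) ≠ 0}

/-- VOID count vectors: no nucleus of either colour in the `N` annuli. [folklore] -/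
def Bnone (N : ℕ) : Set (Fin N ⊕ Fin N → ℕ∞) :=
  {v | ∀ k, v (Sum.inl k) = 0 ∧ v (Sum.inr k) = 0}

/-- `Bwhite` is the mirror image of `Bblack` under the colour swap. [folklore] -/
theorem mem_Bwhite_iff_comp_swap {N : ℕ} (v : Fin N ⊕ Fin N → ℕ∞) :
    v ∈ Bwhite N ↔ v ∘ Sum.swap ∈ Bblack N := Iff.rfl

/-- **The four events cover everything**: look at the first annulus containing a nucleus.
[folklore] -/
theorem mem_union_B {N : ℕ} (v : Fin N ⊕ Fin N → ℕ∞) :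
    v ∈ Bblack N ∪ Bwhite N ∪ Btie N ∪ Bnone N := by
  by_cases hnone : ∀ k, v (Sum.inl k) = 0 ∧ v (Sum.inr k) = 0
  · exact Or.inr hnone
  push Not at hnone
  -- the least index of an occupied annulus
  have hex : ∃ m, ∃ h : m < N, ¬ (v (Sum.inl ⟨m, h⟩) = 0 ∧ v (Sum.inr ⟨m, h⟩) = 0) := by
    obtain ⟨k, hk⟩ := hnone
    exact ⟨k.1, k.2, fun h => hk h.1 h.2⟩
  classical
  let m := Nat.find hex
  obtain ⟨hm, hmocc⟩ := Nat.find_spec hex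
  have hmin : ∀ j : Fin N, j < (⟨m, hm⟩ : Fin N) → v (Sum.inl j) = 0 ∧ v (Sum.inr j) = 0 := by
    intro j hj
    have hj' : (j : ℕ) < m := hj
    have := Nat.find_min hex hj'
    push Not at this
    exact this j.2
  set k : Fin N := ⟨m, hm⟩ with hk
  by_cases hb : v (Sum.inl k) = 0
  · -- the first occupied annulus has a white nucleus only: WHITE
    have hw : v (Sum.inr k) ≠ 0 := fun h => hmocc ⟨hb, h⟩
    refine Or.inl (Or.inl (Or.inr ⟨k, hw, fun j hj => ?_⟩))
    rcases hj.lt_or_eq with hlt | rfl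
    · exact (hmin j hlt).1
    · exact hb
  · by_cases hw : v (Sum.inr k) = 0
    · -- black nucleus only: BLACK
      refine Or.inl (Or.inl (Or.inl ⟨k, hb, fun j hj => ?_⟩))
      rcases hj.lt_or_eq with hlt | rfl
      · exact (hmin j hlt).2
      · exact hw
    · -- both: TIE
      exact Or.inl (Or.inr ⟨k, hb, hw⟩)

/-! ### Colour forcing -/

/-- Distances from `p` to dilated points: `dist p (s z) = s · dist z (p/s)` (`s > 0`). [folklore] -/
theorem dist_ofReal_mul {s : ℝ} (hs : 0 < s) (p z : ℂ) :
    dist p ((s : ℂ) * z) = s * dist z (p / s) := by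
  have hs' : (s : ℂ) ≠ 0 := Complex.ofReal_ne_zero.2 hs.ne'
  have : p = (s : ℂ) * (p / s) := by field_simp
  conv_lhs => rw [this]
  rw [dist_eq_norm, ← mul_sub, norm_mul, Complex.norm_real, Real.norm_eq_abs, abs_of_pos hs,
    ← dist_eq_norm, dist_comm]

/-- A nucleus of `d` in annulus `k` around `p/s` puts the dilated configuration `s • d` within
distance `< s (k+1) w` of `p`. [folklore] -/
theorem infDist_lt_of_count_shell_ne_zero {s : ℝ} (hs : 0 < s) (p : ℂ) (w : ℝ) (k : ℕ)
    (d : PointConfig ℂ) (h : d.count (shell (p / s) w k) ≠ 0) :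
    Metric.infDist p ((s : ℂ) • (d : Set ℂ)) < s * (((k : ℝ) + 1) * w) := by
  obtain ⟨z, hz, hzs⟩ := (count_ne_zero_iff d _).1 h
  have hmem : (s : ℂ) * z ∈ (s : ℂ) • (d : Set ℂ) := Set.smul_mem_smul_set hz
  calc Metric.infDist p ((s : ℂ) • (d : Set ℂ)) ≤ dist p ((s : ℂ) * z) :=
        Metric.infDist_le_dist_of_mem hmem
    _ = s * dist z (p / s) := dist_ofReal_mul hs p z
    _ < s * (((k : ℝ) + 1) * w) := mul_lt_mul_of_pos_left hzs.2 hs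

/-- If a NON-EMPTY configuration `e` has no nucleus in the annuli `0, …, k` around `p/s`
(`w > 0`), then `s • e` stays at distance `≥ s (k+1) w` from `p`. [folklore] -/
theorem le_infDist_of_forall_count_shell_eq_zero {s : ℝ} (hs : 0 < s) (p : ℂ) {w : ℝ}
    (hw : 0 < w) (k : ℕ) (e : PointConfig ℂ) (hne : (e : Set ℂ).Nonempty)
    (h : ∀ j, j ≤ k → e.count (shell (p / s) w j) = 0) :
    s * (((k : ℝ) + 1) * w) ≤ Metric.infDist p ((s : ℂ) • (e : Set ℂ)) := by
  by_contra hlt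
  rw [not_le, Metric.infDist_lt_iff (hne.smul_set)] at hlt
  obtain ⟨y, hy, hpy⟩ := hlt
  obtain ⟨z, hz, rfl⟩ := Set.mem_smul_set.1 hy
  rw [smul_eq_mul, dist_ofReal_mul hs p z] at hpy
  have hz' : dist z (p / s) < (((k + 1 : ℕ) : ℝ)) * w := by
    push_cast
    exact lt_of_mul_lt_mul_left hpy hs.le
  obtain ⟨j, hj, hzj⟩ := exists_mem_shell hw hz'
  exact (count_ne_zero_iff e _).2 ⟨z, hz, hzj⟩ (h j (Nat.lt_succ_iff.1 hj))

/-- **Colour forcing, black.** If the count vector of the site at `p` (annuli `shell (p/s) w k`,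
`k < N`) lies in `Bblack N` and the white configuration is non-empty, then `p` is black for the
block colouring: `infDist p (s • c₁) ≤ infDist p (s • c₂)`. [folklore] -/
theorem infDist_le_of_mem_Bblack {ι : Type*} {x : ι → ℂ} {s w : ℝ} (hs : 0 < s) (hw : 0 < w)
    {N : ℕ} (p : ι → ℂ) (hx : ∀ i, x i = p i / s) (i : ι) (c : PointConfig ℂ × PointConfig ℂ)
    (hne : (c.2 : Set ℂ).Nonempty)
    (h : siteCounts (fun i (k : Fin N) => shell (x i) w k) i c ∈ Bblack N) :
    Metric.infDist (p i) ((s : ℂ) • (c.1 : Set ℂ)) ≤ Metric.infDist (p i) ((s : ℂ) • (c.2 : Set ℂ)) := by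
  obtain ⟨k, hk, hk'⟩ := h
  simp only [siteCounts_inl, siteCounts_inr, hx] at hk hk'
  have h1 := infDist_lt_of_count_shell_ne_zero hs (p i) w k c.1 hk
  have h2 : s * (((k : ℕ) : ℝ) + 1) * w ≤ Metric.infDist (p i) ((s : ℂ) • (c.2 : Set ℂ)) := by
    rw [mul_assoc]
    refine le_infDist_of_forall_count_shell_eq_zero hs (p i) hw k c.2 hne fun j hj => ?_
    exact hk' ⟨j, lt_of_le_of_lt hj k.2⟩ hj
  rw [mul_assoc] at h2
  exact (h1.le.trans h2)

/-- **Colour forcing, white.** If the count vector lies in `Bwhite N` and the black configuration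
is non-empty, then `p` is NOT black: `infDist p (s • c₂) < infDist p (s • c₁)`. [folklore] -/
theorem infDist_lt_of_mem_Bwhite {ι : Type*} {x : ι → ℂ} {s w : ℝ} (hs : 0 < s) (hw : 0 < w)
    {N : ℕ} (p : ι → ℂ) (hx : ∀ i, x i = p i / s) (i : ι) (c : PointConfig ℂ × PointConfig ℂ)
    (hne : (c.1 : Set ℂ).Nonempty)
    (h : siteCounts (fun i (k : Fin N) => shell (x i) w k) i c ∈ Bwhite N) :
    Metric.infDist (p i) ((s : ℂ) • (c.2 : Set ℂ)) < Metric.infDist (p i) ((s : ℂ) • (c.1 : Set ℂ)) := by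
  obtain ⟨k, hk, hk'⟩ := h
  simp only [siteCounts_inl, siteCounts_inr, hx] at hk hk'
  have h1 := infDist_lt_of_count_shell_ne_zero hs (p i) w k c.2 hk
  have h2 : s * ((((k : ℕ) : ℝ) + 1) * w) ≤ Metric.infDist (p i) ((s : ℂ) • (c.1 : Set ℂ)) := by
    refine le_infDist_of_forall_count_shell_eq_zero hs (p i) hw k c.1 hne fun j hj => ?_
    exact hk' ⟨j, lt_of_le_of_lt hj k.2⟩ hj
  exact h1.trans_le h2

/-! ### One site under `P ⊗ P`: swap symmetry, void and tie estimates, fairness -/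

section OneSite

variable {P : Measure (PointConfig ℂ)} {ι : Type*} (x : ι → ℂ) (w : ℝ) (N : ℕ)

/-- The cell family of the sites: `N` annuli of width `w` around each microscopic position `x i`.
[folklore] -/
def cells (i : ι) (k : Fin N) : Set ℂ := shell (x i) w k

/-- The cells are measurable. [folklore] -/
theorem measurableSet_cells (i : ι) (k : Fin N) : MeasurableSet (cells x w N i k) :=
  measurableSet_shell _ _ _

variable {x w N}

/-- **Swap symmetry**: under `P ⊗ P` the white-forcing event of a site is as likely as the
black-forcing one (`Measure.prod_swap`). [folklore] -/
theorem measureReal_Bwhite_eq [SFinite P] (i : ι) :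
    (P.prod P).real (siteCounts (cells x w N) i ⁻¹' Bwhite N) =
      (P.prod P).real (siteCounts (cells x w N) i ⁻¹' Bblack N) := by
  have hset : siteCounts (cells x w N) i ⁻¹' Bwhite N =
      Prod.swap ⁻¹' (siteCounts (cells x w N) i ⁻¹' Bblack N) := by
    ext c
    rw [Set.mem_preimage, mem_Bwhite_iff_comp_swap, Set.mem_preimage, Set.mem_preimage,
      siteCounts_swap]
  rw [hset, measureReal_def, measureReal_def, ← Measure.map_apply measurable_swap
    (measurableSet_siteCounts_preimage (measurableSet_cells x w N) i _), Measure.prod_swap]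

/-- **Void estimate**: `(P ⊗ P)(Bnone) ≤ e^{-2 π (N w)²}` — on `Bnone` both configurations are
void in the disc of radius `N w` around `x i` (Kingman 1993, §2.1, void probability). [folklore] -/
theorem measureReal_Bnone_le (hP : IsPoissonPointProcess (volume : Measure ℂ) P) (hw : 0 < w)
    (i : ι) :
    (P.prod P).real (siteCounts (cells x w N) i ⁻¹' Bnone N) ≤
      Real.exp (-2 * (Real.pi * ((N : ℝ) * w) ^ 2)) := by
  haveI := hP.isProbabilityMeasure
  set D := Metric.ball (x i) ((N : ℝ) * w) with hD
  have hvoid : ∀ d : PointConfig ℂ, (∀ k : Fin N, d.count (shell (x i) w k) = 0) → d.count D = 0 := by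
    intro d hd
    refine (count_eq_zero_iff d D).2 fun z hz hzD => ?_
    rw [hD, Metric.mem_ball] at hzD
    obtain ⟨k, hk, hzk⟩ := exists_mem_shell hw hzD
    exact (count_ne_zero_iff d _).2 ⟨z, hz, hzk⟩ (hd ⟨k, hk⟩)
  have hsub : siteCounts (cells x w N) i ⁻¹' Bnone N ⊆
      {d : PointConfig ℂ | d.count D = 0} ×ˢ {e : PointConfig ℂ | e.count D = 0} := by
    intro c hc
    simp only [Set.mem_preimage, Bnone, Set.mem_setOf_eq, siteCounts_inl, siteCounts_inr,
      cells] at hc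
    exact ⟨hvoid c.1 fun k => (hc k).1, hvoid c.2 fun k => (hc k).2⟩
  have hDvol : (volume D).toReal = Real.pi * ((N : ℝ) * w) ^ 2 := by
    rw [← measureReal_def, hD, volume_real_ball (x i) (by positivity)]
  calc (P.prod P).real (siteCounts (cells x w N) i ⁻¹' Bnone N)
      ≤ (P.prod P).real ({d : PointConfig ℂ | d.count D = 0} ×ˢ {e : PointConfig ℂ | e.count D = 0}) :=
        measureReal_mono hsub (measure_ne_top _ _)
    _ = Real.exp (-(volume D).toReal) * Real.exp (-(volume D).toReal) := by
        rw [measureReal_prod_prod, hP.measureReal_count_eq_zero measurableSet_ball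
          (volume_ball_ne_top _ _)]
    _ = Real.exp (-2 * (Real.pi * ((N : ℝ) * w) ^ 2)) := by
        rw [← Real.exp_add, hDvol]; ring_nf

/-- The probability that an annulus contains a nucleus is at most its area
(`1 - e^{-a} ≤ a`). [folklore] -/
theorem measureReal_count_ne_zero_le (hP : IsPoissonPointProcess (volume : Measure ℂ) P)
    {t : Set ℂ} (ht : MeasurableSet t) (hfin : volume t ≠ ∞) :
    P.real {d | d.count t ≠ 0} ≤ volume.real t := by
  haveI := hP.isProbabilityMeasure
  have hc : {d : PointConfig ℂ | d.count t ≠ 0} = {d : PointConfig ℂ | d.count t = 0}ᶜ := by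
    ext d; simp
  have hm : MeasurableSet {d : PointConfig ℂ | d.count t = 0} :=
    PointConfig.measurable_count ht (measurableSet_singleton 0)
  rw [hc, probReal_compl_eq_one_sub hm, measureReal_def]
  exact hP.one_sub_measureReal_count_eq_zero_le ht hfin

/-- **Tie estimate**: `(P ⊗ P)(Btie) ≤ Σ_k P(N₁(shell k) ≠ 0) P(N₂(shell k) ≠ 0) ≤ Σ_k |shell k|²
≤ 2 V² / N` with `V = π (N w)²`. [folklore] -/
theorem measureReal_Btie_le (hP : IsPoissonPointProcess (volume : Measure ℂ) P) (hw : 0 < w)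
    (i : ι) :
    (P.prod P).real (siteCounts (cells x w N) i ⁻¹' Btie N) ≤
      2 * (Real.pi * ((N : ℝ) * w) ^ 2) ^ 2 / N := by
  haveI := hP.isProbabilityMeasure
  set lam : Fin N → ℝ := fun k => volume.real (shell (x i) w k) with hlam
  have hlam0 : ∀ k, 0 ≤ lam k := fun k => measureReal_nonneg
  have hlamle : ∀ k : Fin N, lam k ≤ Real.pi * w ^ 2 * (2 * N) := by
    intro k
    refine (volume_real_shell_le (x i) hw.le k).trans ?_
    have : (2 * (k : ℕ) + 1 : ℝ) ≤ 2 * N := by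
      have := k.2
      have h' : ((k : ℕ) : ℝ) + 1 ≤ N := by exact_mod_cast this
      linarith
    exact mul_le_mul_of_nonneg_left this (by positivity)
  have hsum : ∑ k : Fin N, lam k ≤ Real.pi * ((N : ℝ) * w) ^ 2 := sum_volume_real_shell_le (x i) hw N
  have hset : siteCounts (cells x w N) i ⁻¹' Btie N =
      ⋃ k : Fin N, ({d : PointConfig ℂ | d.count (shell (x i) w k) ≠ 0} ×ˢ
        {e : PointConfig ℂ | e.count (shell (x i) w k) ≠ 0}) := by
    ext c
    simp only [Set.mem_preimage, Btie, Set.mem_setOf_eq, siteCounts_inl, siteCounts_inr, cells,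
      Set.mem_iUnion, Set.mem_prod]
  calc (P.prod P).real (siteCounts (cells x w N) i ⁻¹' Btie N)
      ≤ ∑ k : Fin N, (P.prod P).real ({d : PointConfig ℂ | d.count (shell (x i) w k) ≠ 0} ×ˢ
          {e : PointConfig ℂ | e.count (shell (x i) w k) ≠ 0}) := by
        rw [hset]; exact measureReal_iUnion_fintype_le _
    _ ≤ ∑ k : Fin N, lam k * lam k := by
        refine Finset.sum_le_sum fun k _ => ?_
        rw [measureReal_prod_prod]
        have h1 := measureReal_count_ne_zero_le hP (measurableSet_shell (x i) w k)
          (volume_shell_ne_top _ _ _)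
        exact mul_le_mul h1 h1 measureReal_nonneg (hlam0 k)
    _ ≤ ∑ k : Fin N, lam k * (Real.pi * w ^ 2 * (2 * N)) :=
        Finset.sum_le_sum fun k _ => mul_le_mul_of_nonneg_left (hlamle k) (hlam0 k)
    _ = (∑ k : Fin N, lam k) * (Real.pi * w ^ 2 * (2 * N)) := (Finset.sum_mul _ _ _).symm
    _ ≤ (Real.pi * ((N : ℝ) * w) ^ 2) * (Real.pi * w ^ 2 * (2 * N)) :=
        mul_le_mul_of_nonneg_right hsum (by positivity)
    _ = 2 * (Real.pi * ((N : ℝ) * w) ^ 2) ^ 2 / N := by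
        rcases Nat.eq_zero_or_pos N with hN | hN
        · subst hN; simp
        · have hN' : (N : ℝ) ≠ 0 := by exact_mod_cast hN.ne'
          field_simp

/-- **The four probabilities sum to at least one** (the four events cover). [folklore] -/
theorem one_le_sum_measureReal_B [IsProbabilityMeasure P] (i : ι) :
    1 ≤ (P.prod P).real (siteCounts (cells x w N) i ⁻¹' Bblack N) +
      (P.prod P).real (siteCounts (cells x w N) i ⁻¹' Bwhite N) +
      (P.prod P).real (siteCounts (cells x w N) i ⁻¹' Btie N) +
      (P.prod P).real (siteCounts (cells x w N) i ⁻¹' Bnone N) := by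
  set Z := siteCounts (cells x w N) i
  have hcov : (Set.univ : Set (PointConfig ℂ × PointConfig ℂ)) ⊆
      Z ⁻¹' Bblack N ∪ Z ⁻¹' Bwhite N ∪ Z ⁻¹' Btie N ∪ Z ⁻¹' Bnone N := by
    intro c _
    simpa only [Set.mem_union, Set.mem_preimage] using mem_union_B (Z c)
  have h0 : (P.prod P).real Set.univ ≤
      (P.prod P).real (Z ⁻¹' Bblack N ∪ Z ⁻¹' Bwhite N ∪ Z ⁻¹' Btie N ∪ Z ⁻¹' Bnone N) :=
    measureReal_mono hcov (measure_ne_top _ _)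
  have h1 := measureReal_union_le (μ := P.prod P)
    (Z ⁻¹' Bblack N ∪ Z ⁻¹' Bwhite N ∪ Z ⁻¹' Btie N) (Z ⁻¹' Bnone N)
  have h2 := measureReal_union_le (μ := P.prod P) (Z ⁻¹' Bblack N ∪ Z ⁻¹' Bwhite N) (Z ⁻¹' Btie N)
  have h3 := measureReal_union_le (μ := P.prod P) (Z ⁻¹' Bblack N) (Z ⁻¹' Bwhite N)
  rw [probReal_univ] at h0
  linarith

/-- **Fairness bound for one site.** Under `P ⊗ P` with `P` Poisson of Lebesgue intensity, the
black-forcing event of a site has probability at least `(1 - e^{-2V} - 2V²/N)/2`, `V = π (N w)²`: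
black and white are equally likely by symmetry, and the rest is void or tie. [folklore] -/
theorem half_le_measureReal_Bblack (hP : IsPoissonPointProcess (volume : Measure ℂ) P)
    (hw : 0 < w) (i : ι) :
    (1 - Real.exp (-2 * (Real.pi * ((N : ℝ) * w) ^ 2)) -
        2 * (Real.pi * ((N : ℝ) * w) ^ 2) ^ 2 / N) / 2 ≤
      (P.prod P).real (siteCounts (cells x w N) i ⁻¹' Bblack N) := by
  haveI := hP.isProbabilityMeasure
  have h1 := one_le_sum_measureReal_B (P := P) (x := x) (w := w) (N := N) i
  rw [measureReal_Bwhite_eq] at h1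
  have h2 := measureReal_Bnone_le (x := x) (N := N) hP hw i
  have h3 := measureReal_Btie_le (x := x) (N := N) hP hw i
  linarith

/-- The same bound for the white-forcing event. [folklore] -/
theorem half_le_measureReal_Bwhite (hP : IsPoissonPointProcess (volume : Measure ℂ) P)
    (hw : 0 < w) (i : ι) :
    (1 - Real.exp (-2 * (Real.pi * ((N : ℝ) * w) ^ 2)) -
        2 * (Real.pi * ((N : ℝ) * w) ^ 2) ^ 2 / N) / 2 ≤
      (P.prod P).real (siteCounts (cells x w N) i ⁻¹' Bwhite N) := by
  haveI := hP.isProbabilityMeasure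
  rw [measureReal_Bwhite_eq]
  exact half_le_measureReal_Bblack hP hw i

end OneSite

/-! ### Registered sub-goal of the stub (Part 3) -/

/-- **Part 3 of stub `stub_smallCells`, registered sub-goal** (`--supports stmt-CriticalPhenomena-6434`):
the fairness bound `half_le_measureReal_Bblack` as a closed statement. [folklore] -/
theorem stub_smallCells_part3 : ∀ {P : Measure (PointConfig ℂ)} {ι : Type*} {x : ι → ℂ} {w : ℝ}
    {N : ℕ}, IsPoissonPointProcess (volume : Measure ℂ) P → 0 < w → ∀ i : ι,
    (1 - Real.exp (-2 * (Real.pi * ((N : ℝ) * w) ^ 2)) -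
        2 * (Real.pi * ((N : ℝ) * w) ^ 2) ^ 2 / N) / 2 ≤
      (P.prod P).real (siteCounts (cells x w N) i ⁻¹' Bblack N) := by
  intro P ι x w N hP hw i
  exact half_le_measureReal_Bblack hP hw i

end Summit.CriticalPhenomena.CardyFormulaZ2.Cruxes.SquareFromVoronoiHub.VoronoiBlocks.SmallCells

end
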